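import Summits.ABC.IUTFork.Joshi.LogVolumesHullsAdelic
import Summits.ABC.IUTFork.Joshi.LogVolumesHullsLocalField

/-!
# [J-III] Rmk. 9.9.7 «one recovers Mochizuki's multiplicative action of theta-values on log-shells» — TYPED WITH
# CONTENT: the recovered action as a predicate on the §9.9 scaling datum, PROVED equivalent to (9.9.2)–(9.9.3)

K. Joshi, *Construction of Arithmetic Teichmüller Spaces III* (arXiv:2401.13508 **v4**, unrefereed, «Preliminary
version for comments»; bib `Joshi2024ATS3`; render `HOME/lit/renders/Joshi-arxiv-2401.13508/pNNNN.txt`, «p.N l.M» =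
PDF page, line of that page file), Rmk. 9.9.7, p.121 l.167–172, VERBATIM: «It is precisely because of Lemma 9.8.2.7
and the property established by Equation (9.9.2) in the proof of Theorem 9.9.1 that one recovers Mochizuki's
multiplicative action of theta-values on log-shells depicted in [Mochizuki, 2021c, Figure 3.1], i.e. multiplication
by theta-value on the log-shell, used in [Mochizuki, 2021c, Theorem 3.11] for defining Θ̃^𝓘_Mochizuki instead of
constructing crystalline Galois cohomology classes as has been done here.» Registry row J3:Rmk9.9.7 (cell abc-iut,
block E, rung LADDER-ABC:A2.E; seat E-t23, slot T-23 companion; E-plan-2 ruling R-a left Thm. 9.9.1 / Rmk. 9.9.7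
with E-t4's spine `ATS3.LocusDatum` (p428048) — this file types the remark ON THAT SPINE'S INPUT SIDE, over the T-23
carriers `LogVol.ScalingDatum` (p429684) / `LogVol.VolumeDatum` (p428811), importing them BY NAME; R14-clean: no
frozen `Thm311*` / `Cor312*` file is imported, OUR decls are cited in docstrings only).

WHAT IS TYPED. Lemma 9.8.2.7 with (9.9.2) is the norm identity (9.9.3) `|log_BK(ξ_{w,j})|_{L′_{w,j}} =
|q^{1/2ℓ}_{w;j}|_{L′_{w,j}}` — on the T-23 carrier the named input `ScalingDatum.NormLogBK` (`|τ_j| = |qrt_j|`, τ_j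
the exhibited class, `qrt_j` the Tate-parameter root). «Multiplication by theta-value on the log-shell» (Mochizuki's
side: [IUTchIII] Thm. 3.11 (i)(b), p.153 l.44 – p.154 l.15, the splitting monoid `Ψ⊥_LGP(…)_v ⊆ ∏_j 𝓘^ℚ(…)`
«equipped with a(n) [multiplicative] action on ∏_{j∈𝔽_l^⋇} 𝓘^ℚ(^{S±_{j+1},j};n,∘𝒟⊢_v)»; Fig. 3.1 p.101 «q^{j²} ↷»;
Prop. 3.4 (ii) p.103 «acts multiplicatively on 𝓘^ℚ») produces, at a label `j` and a place, the REGION `q_j · R`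
swept out by the theta value on a region `R` of the log-shell line. The recovery the remark asserts is typed as the
predicate `ScalingDatum.ThetaActionRecovered`: **`τ_j · 𝒪_{L′_{w,j}} = q^{1/2ℓ}_{w;j} · 𝒪_{L′_{w,j}}` for every
label** — Joshi's class and the theta-value root generate THE SAME `𝒪`-region (the region Lem. 9.10.7.1 / Thm.
9.11.1 actually consume, p.127 l.45–52 «(τ_1𝒪)⊗…⊗(τ_{ℓ*}𝒪)») — and, for a general `𝒪`-stable region `R_j` (the
log-shell itself when it is an `𝒪_{L′_{w,j}}`-submodule), `ThetaActionRecoveredOn R`: `τ_j · R_j = qrt_j · R_j`.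

WHAT IS PROVED (standard valuation-theoretic bookkeeping; nothing of Joshi's or Mochizuki's is asserted).
(1) `normLogBK_of_thetaActionRecovered`: the recovered action IMPLIES (9.9.2)–(9.9.3) — unconditionally on the
signature (`Vol(λ𝒪) = |λ|` makes `|λ|` the greatest norm on `λ𝒪`). (2) `thetaActionRecovered_of_normLogBK`: the
converse holds under the side condition `VolumeDatum.UnitBallSubsetO` («`|x| ≤ 1 ⇒ x ∈ 𝒪`», i.e. `𝒪` IS the valuation
ring of `|−|`; the signature p428811 only records `𝒪 ⊆ {|x| ≤ 1}`), PROVED in both genuine models (`ℚ_p`, p430954;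
any local field, p432005): then `τ_j = u_j · qrt_j` with `u_j ∈ 𝒪^×`, and units do not move `𝒪`-stable regions. So
on the T-23 carrier Rmk. 9.9.7's «recovered multiplicative action» and the crystalline-class norm identity are
INTERCHANGEABLE inputs of E-t4's spine at `w` (`valuationScaling_of_thetaAction`, `fundamentalEstimateVol_of_thetaAction`,
`cor91111_of_thetaAction`). (3) `twist`: replacing the exhibited classes `τ_j` by unit multiples `u_j τ_j` (`|u_j| = 1`)
changes NEITHER the recovered regions NOR the projection onto E-t4's carrier (`twist_toLocusDatum`) — the kernel form of
«instead of constructing crystalline Galois cohomology classes»: the spine cannot distinguish a class from a theta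
value of the same norm. Mochizuki's own generator is `ω · q^{j²}` with `ω ∈ μ_{2l}` (splitting monoid «up to torsion»,
[IUTchII] Cor. 3.5 (iii) / [IUTchIII] Prop. 3.5 (ii)(c); tree: `Literature.IUT.HodgeArakelov.gaussianSplittingMonoid`,
`mem_gaussianSplittingMonoid_iff`), and `|ω| = 1` for ANY absolute value (`abs_eq_one_of_pow_eq_one`): the torsion
ambiguity is a sub-case of the unit ambiguity, both invisible on `𝒪`-regions (`ball_unit_mul`).
(4) LOCATION (numbers, no verdict): at signature level the side condition is load-bearing for (2) —
`signature_sideCondition_needed`: a pair (`𝒪`, `|−|`) satisfying the signature's only constraint `|𝒪| ≤ 1` with two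
elements of equal norm generating different `𝒪`-regions (`ℚ ⊃ ℤ`, trivial absolute value, `2ℤ ≠ 3ℤ`).

OUR SIDE (FQNs for the dictionary seats; not imported here, R14): the Θ-pilot Kummer image generating the regions is
`Summit.ABC.IUTFork.Thm311.MRData.Ψ v hv : Set (StarPacket v)` (Thm311Multirad), the column-`m` Θ-region
`Summit.ABC.IUTFork.Cor312.Setting.thetaRegion m j vQ` (Cor312Statement), at real definitions the (b)-action IS
multiplication (`Summit.ABC.IUTFork.Thm311.Real.mulAction_eq_mul`, `…Real.splittingMonoidLGP`, Thm311RealTateAct /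
Thm311RealTate), the interface field `Literature.IUT.LogThetaLattice.LGPMonoidSignature.bad_gal_acts` ([IUTchIII] Prop.
3.4 (ii) «acts multiplicatively on 𝓘^ℚ»); the loci-to-packets binding is E-t22's `Summit.ABC.IUTFork.Joshi.LociReading`
(`LocusWithinHull`, DictionaryThetaLoci p429683). TEST STATE vs S (`Summit.ABC.IUTFork.Cor312Vol.PilotKummerIndRelated`,
«the q-pilot's Kummer datum is an (Ind1,2)-translate of a Θ-pilot Kummer image»): Rmk. 9.9.7 is a Θ-SIDE sentence (how
the Θ-region is generated); it names no q-pilot datum, so like the other §9.9 rows it is S-BYPASSED (vocabulary) —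
recorded for plan/E/cx/TEST-LEDGER, which rules shapes; no TEST line is claimed here.
FRAMING: locates / conditionally verifies; NO abc claim; no side taken on [IUTchIII] Cor. 3.12 or on any author
(Mochizuki / Scholze–Stix / Joshi); typed ≠ proved; typed AS A CANDIDATE ≠ endorsed; Joshi's remark is a CLAIM
(`@[claim … "disputed"]` predicates), never a fact, never asserted. merge-debt: none (new decls only).
-/

noncomputable section

namespace Summit.ABC.IUTFork.Joshi.LogVol

open MeasureTheory

/-! ## 1. Regions generated by elements of equal norm (one `p`-adic field; standard mathematics) -/

namespace VolumeDatum

variable {E : Type*} [Field E] [MeasurableSpace E] (D : VolumeDatum E)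

/-- **Side condition «`𝒪` is the valuation ring of `|−|`»**: `|x|_E ≤ 1 ⇒ x ∈ 𝒪_E` (with the signature field
`abs_le_one`, `𝒪_E = {|x|_E ≤ 1}`). True for `𝒪_{L′_w} ⊂ L′_w` with its normalised absolute value (p.122 l.32–36);
NOT recorded by the §9.10.2 signature p428811, hence a named hypothesis here, PROVED in the models below. [folklore] -/
def UnitBallSubsetO : Prop := ∀ x : E, D.abs x ≤ 1 → x ∈ D.O

/-- Two elements of equal norm differ by a factor of norm `1`: `|l · l′⁻¹| = 1`. [folklore] -/
theorem abs_mul_inv_eq_one {l l' : E} (hl' : l' ≠ 0) (h : D.abs l = D.abs l') : D.abs (l * l'⁻¹) = 1 := by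
  have h1 : D.abs (l * l'⁻¹) * D.abs l' = 1 * D.abs l' := by
    rw [← D.abs.map_mul, inv_mul_cancel_right₀ hl', h, one_mul]
  exact mul_right_cancel₀ (D.abs.ne_zero_iff.2 hl') h1

/-- Equal norms force both elements to be nonzero as soon as one is. [folklore] -/
theorem ne_zero_of_abs_eq {l l' : E} (hl' : l' ≠ 0) (h : D.abs l = D.abs l') : l ≠ 0 := by
  intro hl
  rw [hl, D.abs.map_zero] at h
  exact D.abs.ne_zero_iff.2 hl' h.symm

/-- **Units do not move `𝒪`-stable regions; elements of EQUAL NORM generate the SAME region.** For an `𝒪`-stable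
set `R ⊆ E` (`u ∈ 𝒪, x ∈ R ⇒ u·x ∈ R`) and `|l| = |l′|`, `l′ ≠ 0`: `l · R = l′ · R`, under `UnitBallSubsetO`
(`l = (l l′⁻¹) · l′` with `l l′⁻¹ ∈ 𝒪`, and symmetrically). [folklore] -/
theorem image_mul_eq_of_abs_eq (hO : D.UnitBallSubsetO) {R : Set E} (hR : ∀ u ∈ D.O, ∀ x ∈ R, u * x ∈ R)
    {l l' : E} (hl' : l' ≠ 0) (h : D.abs l = D.abs l') :
    (fun x => l * x) '' R = (fun x => l' * x) '' R := by
  have key : ∀ {a b : E}, b ≠ 0 → D.abs a = D.abs b →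
      (fun x => a * x) '' R ⊆ (fun x => b * x) '' R := by
    intro a b hb hab
    rintro _ ⟨x, hx, rfl⟩
    refine ⟨a * b⁻¹ * x, hR _ (hO _ (D.abs_mul_inv_eq_one hb hab).le) x hx, ?_⟩
    show b * (a * b⁻¹ * x) = a * x
    rw [← mul_assoc, mul_comm b (a * b⁻¹), inv_mul_cancel_right₀ hb]
  exact (key hl' h).antisymm (key (D.ne_zero_of_abs_eq hl' h) h.symm)

/-- `𝒪` itself is `𝒪`-stable. [folklore] -/
theorem O_mul_stable : ∀ u ∈ D.O, ∀ x ∈ (D.O : Set E), u * x ∈ (D.O : Set E) :=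
  fun _ hu _ hx => D.O.mul_mem hu hx

/-- **Balls of equal radius-norm coincide**: `|l| = |l′| ⇒ l𝒪 = l′𝒪` (under `UnitBallSubsetO`). [folklore] -/
theorem ball_eq_ball_of_abs_eq (hO : D.UnitBallSubsetO) {l l' : E} (hl' : l' ≠ 0) (h : D.abs l = D.abs l') :
    D.ball 0 l = D.ball 0 l' := by
  rw [ball_zero, ball_zero]
  exact D.image_mul_eq_of_abs_eq hO D.O_mul_stable hl' h

/-- **Converse, unconditional on the signature**: `l𝒪 = l′𝒪 ⇒ |l| = |l′|` — `|l|` is the greatest norm on `l𝒪`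
(Lem. 9.10.2.2 (3), `isGreatest_abs_ball`). [folklore] -/
theorem abs_eq_of_ball_eq {l l' : E} (h : D.ball 0 l = D.ball 0 l') : D.abs l = D.abs l' := by
  have h' : IsGreatest (D.abs '' D.ball 0 l) (D.abs l') := by rw [h]; exact D.isGreatest_abs_ball l'
  exact (D.isGreatest_abs_ball l).unique h'

/-- `l𝒪 = l′𝒪 ⇔ |l| = |l′|` (`l′ ≠ 0`, under `UnitBallSubsetO`). [folklore] -/
theorem ball_eq_ball_iff_abs_eq (hO : D.UnitBallSubsetO) {l l' : E} (hl' : l' ≠ 0) :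
    D.ball 0 l = D.ball 0 l' ↔ D.abs l = D.abs l' :=
  ⟨D.abs_eq_of_ball_eq, D.ball_eq_ball_of_abs_eq hO hl'⟩

/-- **A unit twist is invisible on the ball**: `|u| = 1 ⇒ (u·l)𝒪 = l𝒪`. [folklore] -/
theorem ball_unit_mul (hO : D.UnitBallSubsetO) {u l : E} (hu : D.abs u = 1) (hl : l ≠ 0) :
    D.ball 0 (u * l) = D.ball 0 l :=
  D.ball_eq_ball_of_abs_eq hO hl (by rw [D.abs.map_mul, hu, one_mul])

/-- **Torsion has norm one** for ANY absolute value: `ω^n = 1`, `n ≠ 0` `⇒ |ω| = 1` — Mochizuki's splitting-monoid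
generators `ω · q^{j²}`, `ω ∈ μ_{2l}` ([IUTchII] Cor. 3.5 (iii); tree `Literature.IUT.HodgeArakelov.gaussianSplittingMonoid`)
are unit twists of the theta values in the sense of `ball_unit_mul`. [folklore] -/
theorem abs_eq_one_of_pow_eq_one {ω : E} {n : ℕ} (hn : n ≠ 0) (h : ω ^ n = 1) : D.abs ω = 1 := by
  have h1 : D.abs ω ^ n = 1 := by rw [← D.abs.map_pow, h, D.abs.map_one]
  exact (pow_eq_one_iff_of_nonneg (D.abs.nonneg ω) hn).1 h1

/-- Torsion twists do not move balls: `ω^n = 1 ⇒ (ω·l)𝒪 = l𝒪`. [folklore] -/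
theorem ball_torsion_mul (hO : D.UnitBallSubsetO) {ω l : E} {n : ℕ} (hn : n ≠ 0) (hω : ω ^ n = 1) (hl : l ≠ 0) :
    D.ball 0 (ω * l) = D.ball 0 l :=
  D.ball_unit_mul hO (D.abs_eq_one_of_pow_eq_one hn hω) hl

end VolumeDatum

/-! ## 2. Rmk. 9.9.7 on the scaling datum at a place `w` -/

namespace ScalingDatum

variable {lstar : ℕ} {E : Fin lstar → Type*} [∀ i, Field (E i)] [∀ i, MeasurableSpace (E i)] {X : Type*}
  [MeasurableSpace X] (Dw : ScalingDatum lstar E X)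

/-- **Rmk. 9.9.7 TYPED** (p.121 l.167–172 «one recovers Mochizuki's multiplicative action of theta-values on
log-shells … i.e. multiplication by theta-value on the log-shell, used in [Mochizuki, 2021c, Theorem 3.11] for
defining Θ̃^𝓘_Mochizuki»), on the `𝒪`-balls the §9.10/§9.11 chain consumes (p.127 l.45–52): at every label `j`,
the `𝒪_{L′_{w,j}}`-region generated by Joshi's class `τ_j = log_BK(ξ_{w,j})` IS the translate of `𝒪_{L′_{w,j}}` by
the theta-value root `q^{1/2ℓ}_{w;j}` (Mochizuki's «q^{j²} ↷», Fig. 3.1, at `(w, j)` in Joshi's normalisation):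
`τ_j · 𝒪 = q^{1/2ℓ}_{w;j} · 𝒪`. CLAIM (hypothesis BY NAME; proved EQUIVALENT to `NormLogBK` below, never asserted).
[claim: Joshi2024ATS3, status: disputed] -/
@[claim "Joshi2024ATS3" "disputed"]
def ThetaActionRecovered : Prop := ∀ i, (Dw.D i).ball 0 (Dw.τ i) = (Dw.D i).ball 0 (Dw.qrt i)

/-- **Rmk. 9.9.7 on a general region of the log-shell line** («multiplication by theta-value on the LOG-SHELL»):
for a family of regions `R_j ⊆ L′_{w,j}` (Mochizuki's log-shell `𝓘 ⊋ 𝒪` in general, [AbsTopIII] Def. 5.4 (iii)),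
Joshi's class and the theta-value root sweep out the same region: `τ_j · R_j = q^{1/2ℓ}_{w;j} · R_j`. CLAIM; derived
below for `𝒪`-STABLE `R_j`. [claim: Joshi2024ATS3, status: disputed] -/
@[claim "Joshi2024ATS3" "disputed"]
def ThetaActionRecoveredOn (R : ∀ i, Set (E i)) : Prop :=
  ∀ i, (fun x => Dw.τ i * x) '' R i = (fun x => Dw.qrt i * x) '' R i

/-- The ball form is the region form at `R_j = 𝒪_{L′_{w,j}}`. [folklore] -/
theorem thetaActionRecovered_iff_on_O :
    Dw.ThetaActionRecovered ↔ Dw.ThetaActionRecoveredOn fun i => ((Dw.D i).O : Set (E i)) := by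
  simp only [ThetaActionRecovered, ThetaActionRecoveredOn, VolumeDatum.ball_zero]

/-- **Recovered action ⇒ (9.9.2)–(9.9.3)**, unconditionally: equal balls have equal radius-norms.
[claim: Joshi2024ATS3, status: disputed] -/
theorem normLogBK_of_thetaActionRecovered (h : Dw.ThetaActionRecovered) : Dw.NormLogBK :=
  fun i => (Dw.D i).abs_eq_of_ball_eq (h i)

/-- **(9.9.2)–(9.9.3) ⇒ recovered action** («It is precisely because of Lemma 9.8.2.7 and … (9.9.2) … that one
recovers …»), under the valuation-ring side condition at every label and `q^{1/2ℓ}_{w;j} ≠ 0`. PROVED.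
[claim: Joshi2024ATS3, status: disputed] -/
theorem thetaActionRecovered_of_normLogBK (hO : ∀ i, (Dw.D i).UnitBallSubsetO) (hq : ∀ i, Dw.qrt i ≠ 0)
    (h : Dw.NormLogBK) : Dw.ThetaActionRecovered :=
  fun i => (Dw.D i).ball_eq_ball_of_abs_eq (hO i) (hq i) (h i)

/-- The region form on any `𝒪`-stable family `R_j` (e.g. an `𝒪_{L′_{w,j}}`-submodule log-shell), from
(9.9.2)–(9.9.3). PROVED. [claim: Joshi2024ATS3, status: disputed] -/
theorem thetaActionRecoveredOn_of_normLogBK (hO : ∀ i, (Dw.D i).UnitBallSubsetO) (hq : ∀ i, Dw.qrt i ≠ 0)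
    {R : ∀ i, Set (E i)} (hR : ∀ i, ∀ u ∈ (Dw.D i).O, ∀ x ∈ R i, u * x ∈ R i) (h : Dw.NormLogBK) :
    Dw.ThetaActionRecoveredOn R :=
  fun i => (Dw.D i).image_mul_eq_of_abs_eq (hO i) (hR i) (hq i) (h i)

/-- **Rmk. 9.9.7 ⇔ (9.9.2)–(9.9.3) on the T-23 carrier** (valuation-ring side condition, nonzero roots): the
«recovered multiplicative action» and the crystalline-class norm identity are the same input. PROVED.
[claim: Joshi2024ATS3, status: disputed] -/
theorem thetaActionRecovered_iff_normLogBK (hO : ∀ i, (Dw.D i).UnitBallSubsetO) (hq : ∀ i, Dw.qrt i ≠ 0) :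
    Dw.ThetaActionRecovered ↔ Dw.NormLogBK :=
  ⟨Dw.normLogBK_of_thetaActionRecovered, Dw.thetaActionRecovered_of_normLogBK hO hq⟩

/-! ### E-t4's spine at `w` from the recovered action (Mochizuki-style input) instead of (9.9.2)–(9.9.3) -/

/-- (9.9.4)-folded `ValuationScaling` on E-t4's carrier from the recovered action and the root scaling law.
[claim: Joshi2024ATS3, status: disputed] -/
theorem valuationScaling_of_thetaAction (h : Dw.ThetaActionRecovered)
    (h2 : Dw.RootScaling (ATS3.LocusDatum.scalingExponent lstar)) : Dw.toLocusDatum.ValuationScaling :=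
  Dw.valuationScaling_of (Dw.normLogBK_of_thetaActionRecovered h) h2

/-- Thm. 9.9.1 at `w` (sup form) from the recovered action, the root scaling law and the cross-norm identity.
[claim: Joshi2024ATS3, status: disputed] -/
theorem fundamentalEstimateSup_of_thetaAction (h : Dw.ThetaActionRecovered)
    (h2 : Dw.RootScaling (ATS3.LocusDatum.scalingExponent lstar)) (h3 : Dw.CrossNorm) :
    Dw.toLocusDatum.FundamentalEstimateSup :=
  Dw.fundamentalEstimateSup_of_inputs (Dw.normLogBK_of_thetaActionRecovered h) h2 h3

/-- Thm. 9.11.1 at `w` (volume form) from the recovered action and the root scaling law.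
[claim: Joshi2024ATS3, status: disputed] -/
theorem fundamentalEstimateVol_of_thetaAction (h : Dw.ThetaActionRecovered)
    (h2 : Dw.RootScaling (ATS3.LocusDatum.scalingExponent lstar)) : Dw.toLocusDatum.FundamentalEstimateVol :=
  Dw.fundamentalEstimateVol_of_inputs (Dw.normLogBK_of_thetaActionRecovered h) h2

/-- Cor. 9.11.1.1 at `w` from the recovered action, the root scaling law and the sign convention.
[claim: Joshi2024ATS3, status: disputed] -/
theorem cor91111_of_thetaAction (h : Dw.ThetaActionRecovered)
    (h2 : Dw.RootScaling (ATS3.LocusDatum.scalingExponent lstar)) (h3 : Dw.toLocusDatum.LogVolNonpos) :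
    Dw.toLocusDatum.Cor91111 :=
  Dw.cor91111_of_inputs (Dw.normLogBK_of_thetaActionRecovered h) h2 h3

/-! ### «instead of constructing crystalline Galois cohomology classes»: the spine is blind to unit twists -/

/-- **The unit-twisted datum**: the same scaling datum with the exhibited classes `τ_j` replaced by `u_j · τ_j`,
`u_j` of norm `1` (so `u_j ∈ 𝒪^×` under the side condition) — a class and a theta value of the same norm are two such
choices. The three signature fields mentioning `τ` are re-derived (`u_j τ_j ∈ 𝒪`, `≠ 0`, and the ball-tensor is
unchanged by `ball_unit_mul`). [folklore] -/
def twist (u : ∀ i, E i) (hu : ∀ i, (Dw.D i).abs (u i) = 1) (hO : ∀ i, (Dw.D i).UnitBallSubsetO) :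
    ScalingDatum lstar E X :=
  { Dw with
    τ := fun i => u i * Dw.τ i
    τ_mem := fun i => (Dw.D i).O.mul_mem (hO i _ (hu i).le) (Dw.τ_mem i)
    τ_ne := fun i =>
      mul_ne_zero (fun h0 => zero_ne_one (by rw [← hu i, h0, (Dw.D i).abs.map_zero])) (Dw.τ_ne i)
    tens_subset_locus := by
      have hb : (fun i => (Dw.D i).ball 0 (u i * Dw.τ i)) = fun i => (Dw.D i).ball 0 (Dw.τ i) :=
        funext fun i => (Dw.D i).ball_unit_mul (hO i) (hu i) (Dw.τ_ne i)
      rw [hb]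
      exact Dw.tens_subset_locus }

variable (u : ∀ i, E i) (hu : ∀ i, (Dw.D i).abs (u i) = 1) (hO : ∀ i, (Dw.D i).UnitBallSubsetO)

/-- The twisted classes. [folklore] -/
theorem twist_τ (i : Fin lstar) : (Dw.twist u hu hO).τ i = u i * Dw.τ i := rfl

/-- **The projection onto E-t4's carrier does not see the twist** (`theta_j = |u_j τ_j| = |τ_j|`; all other
fields untouched): every reading predicate of `ATS3.LocusDatum` takes the same value on a class and on a theta value
of the same norm. PROVED. [folklore] -/
theorem twist_toLocusDatum : (Dw.twist u hu hO).toLocusDatum = Dw.toLocusDatum := by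
  have hθ : (fun i => (Dw.D i).abs (u i * Dw.τ i)) = fun i => (Dw.D i).abs (Dw.τ i) :=
    funext fun i => by rw [(Dw.D i).abs.map_mul, hu i, one_mul]
  show ({ qroot := Dw.qroot, qroot_pos := Dw.qroot_pos, qroot_lt_one := Dw.qroot_lt_one,
          theta := fun i => (Dw.D i).abs (u i * Dw.τ i), supNorm := Dw.supNorm,
          hullVol := (Dw.vol (Dw.hull Dw.locus)).toReal } : ATS3.LocusDatum lstar) = _
  rw [hθ]
  rfl

/-- The twist preserves (9.9.2)–(9.9.3). [folklore] -/
theorem twist_normLogBK_iff : (Dw.twist u hu hO).NormLogBK ↔ Dw.NormLogBK := by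
  refine forall_congr' fun i => ?_
  show (Dw.D i).abs (u i * Dw.τ i) = (Dw.D i).abs (Dw.qrt i) ↔ (Dw.D i).abs (Dw.τ i) = (Dw.D i).abs (Dw.qrt i)
  rw [(Dw.D i).abs.map_mul, hu i, one_mul]

/-- The twist preserves the recovered regions. [folklore] -/
theorem twist_thetaActionRecovered_iff : (Dw.twist u hu hO).ThetaActionRecovered ↔ Dw.ThetaActionRecovered := by
  refine forall_congr' fun i => ?_
  show (Dw.D i).ball 0 (u i * Dw.τ i) = (Dw.D i).ball 0 (Dw.qrt i) ↔
    (Dw.D i).ball 0 (Dw.τ i) = (Dw.D i).ball 0 (Dw.qrt i)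
  rw [(Dw.D i).ball_unit_mul (hO i) (hu i) (Dw.τ_ne i)]

/-- In particular, twisting the classes INTO the theta-value roots themselves (`u_j := qrt_j · τ_j⁻¹`, of norm `1`
under `NormLogBK`) lands on a datum whose classes ARE the roots and whose projection is unchanged — the kernel form of
«multiplication by theta-value … instead of constructing crystalline Galois cohomology classes». [folklore] -/
theorem twist_to_roots (hO : ∀ i, (Dw.D i).UnitBallSubsetO) (h : Dw.NormLogBK) :
    ∃ hu : ∀ i, (Dw.D i).abs (Dw.qrt i * (Dw.τ i)⁻¹) = 1,
      (∀ i, (Dw.twist (fun i => Dw.qrt i * (Dw.τ i)⁻¹) hu hO).τ i = Dw.qrt i) ∧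
        (Dw.twist (fun i => Dw.qrt i * (Dw.τ i)⁻¹) hu hO).toLocusDatum = Dw.toLocusDatum := by
  refine ⟨fun i => (Dw.D i).abs_mul_inv_eq_one (Dw.τ_ne i) (h i).symm, fun i => ?_, Dw.twist_toLocusDatum _ _ hO⟩
  rw [twist_τ, inv_mul_cancel_right₀ (Dw.τ_ne i)]

end ScalingDatum

/-! ## 3. The side condition in the genuine models; Rmk. 9.9.7 INHABITED over `ℚ_p` -/

section Models

open Metric Literature.IUT.LogVolume Literature.NumberTheory.GaloisRepresentations.Ultrametric

/-- `ℤ_p = {‖x‖_p ≤ 1}`: the side condition holds for the `ℚ_p` datum (p430954). [folklore] -/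
theorem padicVolumeDatum_unitBallSubsetO (p : ℕ) [Fact p.Prime] [MeasurableSpace ℚ_[p]] [BorelSpace ℚ_[p]] :
    (padicVolumeDatum p).UnitBallSubsetO :=
  fun _ hx => (PadicInt.mem_subring_iff p).2 hx

/-- `𝒪_K = {‖x‖ ≤ 1} = {‖x‖^d ≤ 1}`: the side condition holds for the local-field datum (p432005). [folklore] -/
theorem localFieldVolumeDatum_unitBallSubsetO {K : Type*} [NontriviallyNormedField K] [IsUltrametricDist K]
    [ProperSpace K] [MeasurableSpace K] [BorelSpace K] {ϖ : Kˣ} (hϖ : IsUniformizer ϖ) {d : ℕ} (hd : d ≠ 0)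
    (hmod : ‖(ϖ : K)‖ ^ d = ((residueCard K : ℝ))⁻¹) :
    (localFieldVolumeDatum K hϖ hd hmod).UnitBallSubsetO :=
  fun x hx => show ‖x‖ ≤ 1 from (pow_le_one_iff_of_nonneg (norm_nonneg x) hd).1 hx

variable (p : ℕ) [Fact p.Prime] [MeasurableSpace ℚ_[p]] [BorelSpace ℚ_[p]]

/-- At the `ℚ_p` scaling datum (p432258: class `τ := p`, root `q^{1/2ℓ} := p`) the recovered action holds — here
literally, `pℤ_p = pℤ_p`. [folklore] -/
theorem padicScalingDatum_thetaActionRecovered : (padicScalingDatum p).ThetaActionRecovered := fun _ => rfl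

omit [MeasurableSpace ℚ_[p]] [BorelSpace ℚ_[p]] in
/-- `‖1 + p‖_p = 1`: a non-torsion unit of `ℤ_p`. [folklore] -/
theorem padicNorm_one_add_p : ‖(1 + p : ℚ_[p])‖ = 1 := by
  have hp : ‖(p : ℚ_[p])‖ < 1 := Padic.norm_p_lt_one
  have h1 : ‖(1 : ℚ_[p])‖ = 1 := norm_one
  rw [← h1] at hp
  rw [IsUltrametricDist.norm_add_eq_max_of_norm_ne_norm (ne_of_gt hp), max_eq_left hp.le, h1]

/-- **Rmk. 9.9.7 INHABITED non-trivially over `ℚ_p`**: twisting the class to `τ := (1+p)·p ≠ p = q^{1/2ℓ}` (a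
genuine unit twist, `‖1+p‖_p = 1`), the class and the root DIFFER as elements yet generate the same region
`(1+p)pℤ_p = pℤ_p`, (9.9.2)–(9.9.3) holds, and the projection onto E-t4's carrier is that of the untwisted datum —
obtained through the general theorems, all side conditions being THEOREMS of `ℚ_p`. [folklore] -/
theorem padicTwisted_profile :
    let Dw := (padicScalingDatum p).twist (fun _ => (1 + p : ℚ_[p])) (fun _ => padicNorm_one_add_p p)
      (fun _ => padicVolumeDatum_unitBallSubsetO p)
    (∀ i, Dw.τ i ≠ Dw.qrt i) ∧ Dw.NormLogBK ∧ Dw.ThetaActionRecovered ∧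
      Dw.toLocusDatum = (padicScalingDatum p).toLocusDatum := by
  have hp0 : (p : ℚ_[p]) ≠ 0 := by exact_mod_cast (Fact.out : p.Prime).ne_zero
  refine ⟨fun i h => ?_, ?_, ?_, ScalingDatum.twist_toLocusDatum _ _ _ _⟩
  · -- `(1+p)·p = p` would force `1 + p = 1`, i.e. `p = 0` in `ℚ_p`
    have h' : (1 + p : ℚ_[p]) * p = 1 * p := by rw [one_mul]; exact h
    have h'' := mul_right_cancel₀ hp0 h'
    exact hp0 (by simpa using h'')
  · exact (ScalingDatum.twist_normLogBK_iff _ _ _ _).2 (padicScalingDatum_inputs p).1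
  · exact (ScalingDatum.twist_thetaActionRecovered_iff _ _ _ _).2 (padicScalingDatum_thetaActionRecovered p)

end Models

/-! ## 4. LOCATION: at signature level the side condition is load-bearing (numbers, no verdict) -/

/-- **The §9.10.2 signature alone does not give the recovery**: its only constraint tying `𝒪` to `|−|` is
`|𝒪| ≤ 1`, and there is a pair satisfying it — `ℤ ⊂ ℚ` with the trivial absolute value — in which two nonzero
elements of EQUAL norm (`|2| = |3| = 1`) generate DIFFERENT `𝒪`-regions (`2 ∈ 2ℤ`, `2 ∉ 3ℤ`). So direction (2)
genuinely uses `UnitBallSubsetO` (which fails here: `|1/2| = 1`, `1/2 ∉ ℤ`); in the intended models it holds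
(§3). A statement about the TYPING, not about print. [folklore] -/
theorem signature_sideCondition_needed :
    ∃ (O : Subring ℚ) (abs : AbsoluteValue ℚ ℝ), (∀ x ∈ O, abs x ≤ 1) ∧ abs 2 = abs 3 ∧
      (fun x : ℚ => 2 * x) '' (O : Set ℚ) ≠ (fun x : ℚ => 3 * x) '' (O : Set ℚ) ∧
        ¬ (∀ x : ℚ, abs x ≤ 1 → x ∈ O) := by
  classical
  refine ⟨⊥, AbsoluteValue.trivial, fun x _ => ?_, ?_, fun h => ?_, fun h => ?_⟩
  · rcases eq_or_ne x 0 with rfl | hx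
    · rw [map_zero]; exact zero_le_one
    · rw [AbsoluteValue.trivial_apply hx]
  · rw [AbsoluteValue.trivial_apply two_ne_zero, AbsoluteValue.trivial_apply three_ne_zero]
  · have h2 : (2 : ℚ) ∈ (fun x : ℚ => 2 * x) '' ((⊥ : Subring ℚ) : Set ℚ) :=
      ⟨1, (⊥ : Subring ℚ).one_mem, by norm_num⟩
    rw [h] at h2
    obtain ⟨x, hx, hx2⟩ := h2
    obtain ⟨n, rfl⟩ := Subring.mem_bot.1 hx
    -- `3 n = 2` has no integer solution
    have h3 : (3 * n : ℤ) = 2 := by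
      have h3' : (3 : ℚ) * n = 2 := hx2
      exact_mod_cast h3'
    omega
  · have hmem := h (1 / 2 : ℚ) (by rw [AbsoluteValue.trivial_apply (by norm_num)])
    obtain ⟨n, hn⟩ := Subring.mem_bot.1 hmem
    have h2 : (2 * n : ℤ) = 1 := by
      have : (2 : ℚ) * n = 1 := by rw [hn]; norm_num
      exact_mod_cast this
    omega

end Summit.ABC.IUTFork.Joshi.LogVol

end
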